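import Summits.BirchSwinnertonDyer.BirchSwinnertonDyer.Theorems.UniversalToricDescentThinCombFrameCovariance
import Summits.BirchSwinnertonDyer.BirchSwinnertonDyer.Theorems.UniversalToricDescentThinCombLineValue
import Summits.BirchSwinnertonDyer.Rank1Residual.X2.AvatarValueAbovePSplit
import Summits.BirchSwinnertonDyer.BirchSwinnertonDyer.Theorems.SchneiderFreeAdditiveX3Defs
import Literature.NumberTheory.NumberFields.AdicCompletionIntegersPadicIntOfDegreeOne
import Literature.NumberTheory.GaloisRepresentations.GlobalArtinMapNormProofs
import HarnessLib

/-!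
# GRADING RENORMALISATION of ♯♯-frames: the second grading `Y^b` of `IsToricTwoVarLFunctionUpTo₂` is FREE UP TO `ℤ_pˣ`
# (helper on the rational wall `RationalSplitIMCInclusionAtThree`, stmt-BirchSwinnertonDyer-24207, line `ratwall_thin_comb` v9 → v10;
# cell `pub/bsd-wall`, LEAD `cruxlead-24207` g36; `--supports stmt-BirchSwinnertonDyer-24207`; nothing is closed; BSD is not proved)

WHY THIS FILE. Since v8.3/V84 the first stub of the line `ratwall_thin_comb` is the NORMALISED existence (N): a ♯♯-frame `L₂` of the toric
two-variable `3`-adic `L`-function of `f_E` with second grading PINNED, `Y = X·ι′⁻¹(N·|d_K|/4)` (the display constant of Jacquet's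
functional equation; certificate `…ClosedModuloV84`). LEAD-CENSUS-g33 §3b recorded a worry: from a frame with ARBITRARY `(X, Y)` (v8.2's
clause (i)) the normalisation is reached only «up to a `3`-adic renormalisation index of the frame involution», so (N) might be strictly
stronger than what a construction à la Hida 1988 Thm. 5.1b ⊗ Castella–Wan 2.11 delivers (there the `b`-grading carries the `3`-adic SIZE
`3^{cb}` of the supercuspidal local `ε`-factor times a unit of `ℤ_3 ∩ ℚ`: `λ_3(f) = ±1`, `N/3^c`, `|d_K|`, `4`). This file removes the
worry IN THE KERNEL: the second grading of a ♯♯-frame can be rescaled by ANY `u ∈ ℤ_pˣ` (§4), because the interpolation scope of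
`IsToricTwoVarLFunctionUpTo₂` (everywhere-unramified `ψ` of type `(a, −b)`, any avatar through the pair) is RIGIDLY GRADED on the Galois
side at the conjugate prime: there is a fixed `g_u ∈ Γ_K` with `r_ψ(g_u) = u^b` for all such `ψ` (§3 — Serre's local algebraicity of the
avatar above `p`, read at a unit of `K_{𝔭′} ≅ ℚ_p` through the UNIQUE local embedding, whose exponent is the conjugate one `−b` because
`ι′` induces `𝔭 ≠ 𝔭′`), and multiplying `L₂` by the group-like element of `g_u` multiplies every interpolation value by `u^b` (§1–§2).
Hence (N) ⟺ (N♭) «`Y ∈ X·ι′⁻¹(N·|d_K|/4)·ℤ_3ˣ`» (certificate `…ClosedModuloV85`): the stub can be stated up to `ℤ_3ˣ`, which is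
the currency a typer of Hida 1988 / Hao–Loeffler-type interpolation formulas produces (`Y/X = 3^{v_3(N)} × unit`), with no dependence on
the exact display constant beyond its `3`-adic valuation class.

* §1 `hasValueAt₂_groupLike` — the group-like element `(1+T₁)^{κ₁ g}(1+T₂)^{κ₂ g}` of ANY `g ∈ Γ_K` has the value `r(g)` at the point
  `(r γ₁ − 1, r γ₂ − 1)` of a character `r` through the pair (`FrameValues.coe_eval₂_frameImages`).
* §2 `isToricTwoVarLFunctionUpTo₂_groupLike_mul` — if `r_ψ(g) = ν^b` on the scope, `(group-like of g) · L₂` is a ♯♯-frame with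
  `(C, X, Y·ν)` (`LineValue.hasValueAt₂_mul`).
* §3 `embExponent_localEmbedding_eq_snd` (the exponent of the local embedding at `v̄ ≠ v` is the conjugate exponent `qq`, any type),
  **`exists_avatarValueAt_eq_unit_pow`** — `∀ u ∈ ℤ_pˣ ∃ g_u ∈ Γ_K ∀ ψ (type (a,−b), unramified) ∀ avatar r : r(g_u) = u^b`
  (`PNewDisplay.avatar_entry_eq_of_isPAdicAvatarOf` at `𝔭′`; `𝔭′` of degree one in the quadratic `K`; `K_{𝔭′} ≃ ℚ_p`,
  `padicEquivOfDegreeOne`; local Artin map onto `K_{𝔭′}ˣ`).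
* §4 **`exists_isToricTwoVarLFunctionUpTo₂_rescale_snd`** (`(C, X, Y) ⟹ (C, X, Y·u)` for every `u ∈ ℤ_pˣ`) and
  `exists_isToricTwoVarLFunctionUpTo₂_of_upToUnit` (`(C, X, X·c·u) ⟹ (C, X, X·c)`).

HONEST SCOPE: statements about the interpolation PREDICATE only (what a frame's constants may be renormalised to); nothing here is
evidence that a ♯♯-frame exists at an additive split `3`; nothing is closed; BSD is proved for no curve; 24207 / 20395 / 20186 / 32493 OPEN.

References: [cite: SerreAbelianLadic1968, Ch. III §2.3 (local algebraicity), Ch. III §1.1] [cite: SerreLocalFields1979, Ch. XIII §4 Thm. 2]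
[cite: FrohlichTaylor1990, Ch. III §1 (1.14)(a), Thm. 20] [cite: deShalit1987, II.4.17 (54)] [cite: NeukirchSchmidtWingberg2008, (5.3.5)]
[cite: CastellaWan2023, §2.4 Thm. 2.11 (arXiv:1607.02019)] [cite: HaoLoeffler2025, Thm. 3.5 (arXiv:2405.12611)] [cite: Weil1956, §1]
-/

set_option linter.dupNamespace false
set_option autoImplicit false

noncomputable section

open scoped MatrixGroups
open Filter Topology Field
open Literature.NumberTheory.EllipticCurves Literature.NumberTheory.IwasawaTheory
open Literature.NumberTheory.GaloisRepresentations

namespace Summit.BirchSwinnertonDyer.BirchSwinnertonDyer.Theorems.UniversalToricDescentThinComb.GradingRenormalisation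

open Summit.BirchSwinnertonDyer.Rank1Residual.X11b.Halves
open Summit.BirchSwinnertonDyer.BirchSwinnertonDyer.Theorems.UniversalToricDescentThinComb.FrameValues
open Summit.BirchSwinnertonDyer.BirchSwinnertonDyer.Theorems.UniversalToricDescentThinComb.LineValue

/-! ### §1–§2. Group-like elements: values at interpolation points, and multiplication of a ♯♯-frame -/

section GroupLike

variable {p : ℕ} [Fact p.Prime] {K : Type} [Field K] [NumberField K]
  {κ₁ κ₂ : ZpExtension K p} {γ₁ γ₂ : absoluteGaloisGroup K} {r : FramedGaloisRep K (PadicAlgCl p) 1}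

/-- **The group-like element of `g ∈ Γ_K` has the value `r(g)` at the point of `r`.** For a generator pair
`(κ₁, κ₂; γ₁, γ₂)`, a character `r` through the pair and any `g ∈ Γ_K`, the element
`(1+T₁)^{κ₁ g} (1+T₂)^{κ₂ g} ∈ R₀⟦T₁⟧⟦T₂⟧` (the image of `g` under `ℤ_p⟦Gal(K̃_∞/K)⟧ → Λ₂(R₀)`, `γ_i ↦ 1 + T_i`)
takes at `(r γ₁ − 1, r γ₂ − 1)` the value `r(g)`: the frame monomial of the coordinate column of `g` evaluates to
`r̂(κ₁ g, κ₂ g) = r(g)` (`FrameValues.coe_eval₂_frameImages`). [cite: deShalit1987, II.4.17 (54)]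
[cite: NeukirchSchmidtWingberg2008, (5.3.5)] -/
theorem hasValueAt₂_groupLike (hpair : ZpExtension.IsTopGeneratorPair κ₁ κ₂ γ₁ γ₂)
    (hr : FactorsThroughPair κ₁ κ₂ r) (g : absoluteGaloisGroup K) :
    UnrSeries.HasValueAt₂
      (PowerSeries.map (PowerSeries.C (R := unrIntegers p))
          ((PowerSeries.binomialSeries ℤ_[p] (Multiplicative.toAdd (κ₁ g))).map (toUnr p)) *
        PowerSeries.C ((PowerSeries.binomialSeries ℤ_[p] (Multiplicative.toAdd (κ₂ g))).map (toUnr p)))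
      (avatarValueAt r γ₁ - 1) (avatarValueAt r γ₂ - 1) (avatarValueAt r g) := by
  letI : Algebra ℤ_[p] (unrIntegers p) := (toUnr p).toAlgebra
  haveI := completeSpace_padicComplexInt p
  haveI := isLinearTopology_padicComplexInt p
  set u : 𝓞_ℂ_[p] := ⟨avatarValueAt r γ₁ - 1, avatarValueAt_sub_one_mem hr γ₁⟩ with hu_def
  set v : 𝓞_ℂ_[p] := ⟨avatarValueAt r γ₂ - 1, avatarValueAt_sub_one_mem hr γ₂⟩ with hv_def
  have hu : (u : ℂ_[p]) = avatarValueAt r γ₁ - 1 := rfl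
  have hv : (v : ℂ_[p]) = avatarValueAt r γ₂ - 1 := rfl
  have hu1 : ‖u‖ < 1 := norm_avatarValueAt_sub_one_lt_of_factorsThroughPair hr γ₁
  have hv1 : ‖v‖ < 1 := norm_avatarValueAt_sub_one_lt_of_factorsThroughPair hr γ₂
  -- the coordinate column of `g`
  set A : Matrix (Fin 2) (Fin 2) ℤ_[p] :=
    Matrix.of ![![Multiplicative.toAdd (κ₁ g), Multiplicative.toAdd (κ₁ g)],
      ![Multiplicative.toAdd (κ₂ g), Multiplicative.toAdd (κ₂ g)]] with hA_def
  have hA0 : A 0 0 = Multiplicative.toAdd (κ₁ g) := rfl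
  have hA1 : A 1 0 = Multiplicative.toAdd (κ₂ g) := rfl
  -- the nested element is the frame monomial of column `0`
  have hmap₁ := IwasawaAlgebra₂.map_binomialSeries (unrIntegers p) (Multiplicative.toAdd (κ₁ g))
  have hmap₂ := IwasawaAlgebra₂.map_binomialSeries (unrIntegers p) (Multiplicative.toAdd (κ₂ g))
  rw [RingHom.algebraMap_toAlgebra] at hmap₁ hmap₂
  have hF : nestedPowerSeriesEquiv
      (PowerSeries.map (PowerSeries.C (R := unrIntegers p))
          ((PowerSeries.binomialSeries ℤ_[p] (Multiplicative.toAdd (κ₁ g))).map (toUnr p)) *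
        PowerSeries.C ((PowerSeries.binomialSeries ℤ_[p] (Multiplicative.toAdd (κ₂ g))).map (toUnr p))) =
      IwasawaAlgebra₂.frameImages (unrIntegers p) A 0 + 1 := by
    rw [map_mul, hmap₁, hmap₂, IwasawaAlgebra₂.nestedPowerSeriesEquiv_onePlusT₁Pow,
      IwasawaAlgebra₂.nestedPowerSeriesEquiv_onePlusT₂Pow, IwasawaAlgebra₂.frameImages_def,
      IwasawaAlgebra₂.frameMonomial_def, sub_add_cancel, hA0, hA1]
  have h := hasValueAt₂_eval₂
    (PowerSeries.map (PowerSeries.C (R := unrIntegers p))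
        ((PowerSeries.binomialSeries ℤ_[p] (Multiplicative.toAdd (κ₁ g))).map (toUnr p)) *
      PowerSeries.C ((PowerSeries.binomialSeries ℤ_[p] (Multiplicative.toAdd (κ₂ g))).map (toUnr p))) hu1 hv1
  rw [hF, ← MvPowerSeries.coe_eval₂Hom continuous_unrToInt (hasEval_pair hu1 hv1), map_add, map_one,
    MvPowerSeries.coe_eval₂Hom] at h
  have hval := coe_eval₂_frameImages hpair hr A 0 g hA0 hA1 hu hv hu1 hv1
  have hcoe : (((MvPowerSeries.eval₂ (unrToInt (p := p)) ![u, v] (IwasawaAlgebra₂.frameImages (unrIntegers p) A 0) + 1 :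
      𝓞_ℂ_[p]) : ℂ_[p])) = avatarValueAt r g := by
    push_cast
    rw [hval, sub_add_cancel]
  rw [hcoe] at h
  exact h

/-- **Multiplying a ♯♯-frame by a group-like element RESCALES THE SECOND GRADING.** If `g ∈ Γ_K` has
`r_ψ(g) = ν^b` for every interpolation character `ψ` of type `(a, −b)` (everywhere unramified) and every avatar
`r_ψ` of `ψ`, then for a ♯♯-frame `L₂` with constants `(C, X, Y)` the product `(1+T₁)^{κ₁ g}(1+T₂)^{κ₂ g} · L₂` is a
♯♯-frame with constants `(C, X, Y·ν)`: values multiply (`LineValue.hasValueAt₂_mul`) and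
`ν^b · C X^a Y^b = C X^a (Yν)^b`. [cite: CastellaWan2023, §2.4 Thm. 2.11 (arXiv:1607.02019)]
[cite: HaoLoeffler2025, Thm. 3.5 (arXiv:2405.12611)] -/
theorem isToricTwoVarLFunctionUpTo₂_groupLike_mul {N : ℕ} {ι : PadicAlgCl p ≃+* ℂ}
    {𝔭 𝔭' : IsDedekindDomain.HeightOneSpectrum (NumberField.RingOfIntegers K)}
    (hpair : ZpExtension.IsTopGeneratorPair κ₁ κ₂ γ₁ γ₂)
    {f : CuspForm (CongruenceSubgroup.Gamma0 N) 2} {ΩK : ℂ} {C X Y : ℂ_[p]} {L₂ : PowerSeries (UnrSeries p)}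
    (g : absoluteGaloisGroup K) (ν : ℂ_[p])
    (hg : ∀ (ψ : HeckeCharacter K) (a b : ℕ), 1 ≤ a → 1 ≤ b →
      ψ.HasInfinityType (fun _ ↦ (a : ℤ)) (fun _ ↦ -(b : ℤ)) →
      (∀ w : IsDedekindDomain.HeightOneSpectrum (NumberField.RingOfIntegers K), ψ.IsUnramifiedAt w) →
      ∀ r : FramedGaloisRep K (PadicAlgCl p) 1, IsPAdicAvatarOf ι ψ r → avatarValueAt r g = ν ^ b)
    (hL : IsToricTwoVarLFunctionUpTo₂ C X Y ι 𝔭 𝔭' κ₁ κ₂ γ₁ γ₂ f ΩK L₂) :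
    IsToricTwoVarLFunctionUpTo₂ C X (Y * ν) ι 𝔭 𝔭' κ₁ κ₂ γ₁ γ₂ f ΩK
      ((PowerSeries.map (PowerSeries.C (R := unrIntegers p))
          ((PowerSeries.binomialSeries ℤ_[p] (Multiplicative.toAdd (κ₁ g))).map (toUnr p)) *
        PowerSeries.C ((PowerSeries.binomialSeries ℤ_[p] (Multiplicative.toAdd (κ₂ g))).map (toUnr p))) * L₂) := by
  intro ψ a b ha hb hinf hunr r hψr hrκ L hLd hLe
  have h1 := hasValueAt₂_groupLike hpair hrκ g
  rw [hg ψ a b ha hb hinf hunr r hψr] at h1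
  have h2 := hL ψ a b ha hb hinf hunr r hψr hrκ L hLd hLe
  have hx : ‖avatarValueAt r γ₁ - 1‖ < 1 := norm_avatarValueAt_sub_one_lt_of_factorsThroughPair hrκ γ₁
  have hy : ‖avatarValueAt r γ₂ - 1‖ < 1 := norm_avatarValueAt_sub_one_lt_of_factorsThroughPair hrκ γ₂
  have h := hasValueAt₂_mul hx hy h1 h2
  convert h using 1
  rw [mul_pow]
  ring

end GroupLike

/-! ### §3. The grading element at the conjugate prime: `r_ψ(g_ν) = ν^b` for every `ψ` of type `(a, −b)` -/

section ConjPrime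

open NumberField IsDedekindDomain
open Literature.NumberTheory.NumberFields
open Summit.BirchSwinnertonDyer.Rank1Residual.X2.PNewDisplay

variable {p : ℕ} [Fact p.Prime] {K : Type} [Field K] [NumberField K]

/-- **The exponent of a local embedding at `v̄ ≠ v` is the CONJUGATE exponent.** For `K` with all infinite places
complex, `ι` normalised so that every distinguished embedding `σ_w` induces `v` (`d ∈ v ↔ ‖ι⁻¹(σ_w d)‖ < 1`), and a
continuous `f : K_{v̄} → ℚ̄_p`, the complex embedding `ι ∘ f ∘ ι_{v̄}` is not real and is not the distinguished
embedding of its place (that one induces `v`, while `f ∘ ι_{v̄}` induces `v̄`), so its exponent in the type `(pp, qq)` is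
`qq` of its place (the argument of `…SplitPrimeSaturation.embExponent_localEmbedding_eq_zero`, any `qq`).
[cite: SerreAbelianLadic1968, Ch. III §1.1] [cite: Weil1956, §1] -/
theorem embExponent_localEmbedding_eq_snd (ι : PadicAlgCl p ≃+* ℂ)
    (himag : ∀ w : InfinitePlace K, w.IsComplex)
    {v vbar : HeightOneSpectrum (𝓞 K)} (hne : vbar ≠ v)
    (hι : ∀ (w : InfinitePlace K) (d : 𝓞 K), d ∈ v.asIdeal ↔ ‖ι.symm (w.embedding (d : K))‖ < 1)
    (f : vbar.adicCompletion K →+* PadicAlgCl p) (hf : Continuous f) (pp qq : InfinitePlace K → ℤ) :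
    HeckeCharacter.embExponent pp qq
        ((ι : PadicAlgCl p →+* ℂ).comp (f.comp (algebraMap K (vbar.adicCompletion K)))) =
      qq (InfinitePlace.mk ((ι : PadicAlgCl p →+* ℂ).comp (f.comp (algebraMap K (vbar.adicCompletion K))))) := by
  set e := (ι : PadicAlgCl p →+* ℂ).comp (f.comp (algebraMap K (vbar.adicCompletion K))) with he
  have hnr : ¬ ComplexEmbedding.IsReal e := fun h ↦
    (InfinitePlace.not_isReal_iff_isComplex.mpr (himag (InfinitePlace.mk e)))
      (InfinitePlace.isReal_mk_iff.mpr h)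
  have hneq : ¬ e = (InfinitePlace.mk e).embedding := by
    intro heq
    obtain ⟨d, hd, hdv⟩ : ∃ d : 𝓞 K, d ∈ vbar.asIdeal ∧ d ∉ v.asIdeal := by
      by_contra h
      push Not at h
      exact hne (HeightOneSpectrum.ext (vbar.isMaximal.eq_of_le v.isPrime.ne_top fun d hd ↦ h d hd))
    have h1 : ‖f (algebraMap K (vbar.adicCompletion K) ((d : 𝓞 K) : K))‖ < 1 :=
      (PadicEmbedding.norm_map_algebraMap_lt_one_iff f hf d).mpr hd
    have h2 : ι.symm ((InfinitePlace.mk e).embedding ((d : 𝓞 K) : K)) =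
        f (algebraMap K (vbar.adicCompletion K) ((d : 𝓞 K) : K)) := by
      rw [← heq, he, RingHom.comp_apply, RingHom.comp_apply, RingHom.coe_coe, RingEquiv.symm_apply_apply]
    exact hdv ((hι (InfinitePlace.mk e) d).mpr (by rw [h2]; exact h1))
  unfold HeckeCharacter.embExponent
  rw [if_neg hnr, if_neg hneq]

/-- **THE GRADING ELEMENT AT THE CONJUGATE PRIME.** Let `K` be imaginary quadratic, `p = 𝔭𝔭′` split
(`p ∈ 𝔭`, `p ∈ 𝔭′`, `𝔭′ ≠ 𝔭`), `ι′ : ℚ̄_p ≃ ℂ` inducing `𝔭` (`BranchInducesPrime p ι′ 𝔭`), and `ν ∈ ℤ_pˣ`. There is a FIXED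
`g_ν ∈ Γ_K` — the restriction of a Weil element of `K_{𝔭′} ≅ ℚ_p` whose Artin image is the unit `ν` — such that for EVERY
Hecke character `ψ` of infinity type `(a, −b)` unramified everywhere and EVERY `p`-adic avatar `r` of `ψ`:
**`r(g_ν) = ν^b`**. PROOF: local–global compatibility of the avatar above `p` (`PNewDisplay.avatar_entry_eq_of_isPAdicAvatarOf`,
Serre III §2.3 «locally algebraic»): `r(res w) = ι′⁻¹(ψ(⟨a w⟩_{𝔭′})) · ∏_e e(a w)^{−n_e}`; `ψ` is unramified at `𝔭′` and `a w = ν`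
is a unit, so the first factor is `1`; `𝔭′` has degree one (`[K:ℚ] = 2`, `𝔭′ ≠ 𝔭` both above `p`), so there is exactly one
continuous `e : K_{𝔭′} → ℚ̄_p`, with `e(ν) = ν`, and its exponent is the CONJUGATE one, `−b` (it induces `𝔭′`, not `𝔭`).
This is the `b`-GRADING of a ♯♯-frame read on the Galois side: the second grading `Y^b` of `IsToricTwoVarLFunctionUpTo₂` is
free up to `ℤ_pˣ`. [cite: SerreAbelianLadic1968, Ch. III §2.3] [cite: SerreLocalFields1979, Ch. XIII §4 Thm. 2]
[cite: FrohlichTaylor1990, Ch. III §1 (1.14)(a), Thm. 20] -/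
theorem exists_avatarValueAt_eq_unit_pow (ι : PadicAlgCl p ≃+* ℂ) (hK : IsImaginaryQuadratic K)
    {𝔭 𝔭' : HeightOneSpectrum (𝓞 K)} (h𝔭 : ((p : ℕ) : 𝓞 K) ∈ 𝔭.asIdeal)
    (h𝔭' : ((p : ℕ) : 𝓞 K) ∈ 𝔭'.asIdeal) (hne : 𝔭' ≠ 𝔭)
    (hι : Summit.BirchSwinnertonDyer.BirchSwinnertonDyer.Theorems.SchneiderFree.BranchInducesPrime p ι 𝔭)
    (ν : ℤ_[p]ˣ) :
    ∃ g : absoluteGaloisGroup K, ∀ (ψ : HeckeCharacter K) (a b : ℕ) (r : FramedGaloisRep K (PadicAlgCl p) 1),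
      ψ.HasInfinityType (fun _ ↦ (a : ℤ)) (fun _ ↦ -(b : ℤ)) →
      (∀ w : HeightOneSpectrum (𝓞 K), ψ.IsUnramifiedAt w) → IsPAdicAvatarOf ι ψ r →
        avatarValueAt r g = (algebraMap ℚ_[p] ℂ_[p] ((ν : ℤ_[p]) : ℚ_[p])) ^ b := by
  classical
  haveI : NumberField.IsTotallyComplex K := hK.2
  have himag : ∀ w : InfinitePlace K, w.IsComplex := fun w ↦ NumberField.IsTotallyComplex.isComplex w
  -- `𝔭′` has degree one
  obtain ⟨he, hf⟩ := ramificationIdx_eq_one_and_inertiaDeg_eq_one_of_natCast_mem_of_ne K hK.1 h𝔭' h𝔭 hne.symm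
  haveI := liesOver_ratPlace_of_natCast_mem K 𝔭' h𝔭'
  -- the unit `z ↔ ν` of `K_{𝔭′}`
  set w𝒪 : (𝔭'.adicCompletionIntegers K)ˣ :=
    Units.map (padicIntEquivOfDegreeOne K p 𝔭' he hf).symm.toRingHom.toMonoidHom ν with hw𝒪
  have hz1 : Valued.v (((w𝒪 : 𝔭'.adicCompletionIntegers K) : 𝔭'.adicCompletion K)) = 1 :=
    Literature.NumberTheory.GaloisRepresentations.valued_coe_units_adicCompletionIntegers w𝒪
  have hz0 : (((w𝒪 : 𝔭'.adicCompletionIntegers K) : 𝔭'.adicCompletion K)) ≠ 0 := by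
    intro h; rw [h, map_zero] at hz1; exact zero_ne_one hz1
  set z : (𝔭'.adicCompletion K)ˣ := Units.mk0 _ hz0 with hz
  have hzν : padicEquivOfDegreeOne K p 𝔭' he hf ((z : (𝔭'.adicCompletion K)ˣ) : 𝔭'.adicCompletion K) =
      ((ν : ℤ_[p]) : ℚ_[p]) := by
    rw [hz, Units.val_mk0, ← coe_padicIntEquivOfDegreeOne_apply, hw𝒪]
    simp
  -- the local Artin map and a Weil element over `z`
  obtain ⟨art, ha⟩ := exists_isLocalArtinMap_holds (𝔭'.adicCompletion K)
  obtain ⟨w₀, hw₀⟩ := ha.isOpenQuotientMap_artin.surjective z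
  -- the unique local embedding, explicitly
  set e₀ : 𝔭'.adicCompletion K →+* PadicAlgCl p :=
    (algebraMap ℚ_[p] (PadicAlgCl p)).comp (padicEquivOfDegreeOne K p 𝔭' he hf).toRingHom with he₀
  have he₀c : Continuous e₀ :=
    (continuous_algebraMap ℚ_[p] (PadicAlgCl p)).comp (continuous_padicEquivOfDegreeOne K p 𝔭' he hf)
  refine ⟨absGaloisRestrict K (𝔭'.adicCompletion K) (WeilGroup.toAbsGalois (𝔭'.adicCompletion K) w₀),
    fun ψ a b r hinf hunr hav ↦ ?_⟩
  have key := avatar_entry_eq_of_isPAdicAvatarOf hinf ι (T := ∅) (fun w _ ↦ hunr w) hav h𝔭' art ha w₀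
  rw [hw₀, univ_localEmbedding_eq_singleton h𝔭' he hf ⟨e₀, he₀c⟩, Finset.prod_singleton] at key
  have hψ1 : ψ (localUnits 𝔭' z) = 1 := (hunr 𝔭').map_localUnits_eq_one z (by rw [hz, Units.val_mk0]; exact hz1)
  have hexp : HeckeCharacter.embExponent (fun _ : InfinitePlace K ↦ (a : ℤ)) (fun _ ↦ -(b : ℤ))
      ((ι : PadicAlgCl p →+* ℂ).comp
        ((⟨e₀, he₀c⟩ : {e : 𝔭'.adicCompletion K →+* PadicAlgCl p // Continuous e}).1.comp
          (algebraMap K (𝔭'.adicCompletion K)))) = -(b : ℤ) :=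
    embExponent_localEmbedding_eq_snd ι himag hne hι e₀ he₀c _ _
  have he₀z : e₀ ((z : (𝔭'.adicCompletion K)ˣ) : 𝔭'.adicCompletion K) =
      algebraMap ℚ_[p] (PadicAlgCl p) ((ν : ℤ_[p]) : ℚ_[p]) := by
    rw [he₀, RingHom.comp_apply]
    exact congrArg _ hzν
  rw [hψ1, Units.val_one, map_one, one_mul, hexp, neg_neg, zpow_natCast] at key
  rw [avatarValueAt_eq_entry, key]
  change algebraMap (PadicAlgCl p) ℂ_[p] ((e₀ ((z : (𝔭'.adicCompletion K)ˣ) : 𝔭'.adicCompletion K)) ^ b) = _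
  rw [map_pow, he₀z, ← IsScalarTower.algebraMap_apply]

end ConjPrime

/-! ### §4. THE SECOND GRADING OF A ♯♯-FRAME IS FREE UP TO `ℤ_pˣ` -/

section Rescale

open NumberField IsDedekindDomain

variable {p : ℕ} [Fact p.Prime] {K : Type} [Field K] [NumberField K]
  {κ₁ κ₂ : ZpExtension K p} {γ₁ γ₂ : absoluteGaloisGroup K}

/-- **RESCALING THE SECOND GRADING BY A UNIT OF `ℤ_p`.** In the setting of the line's stubs (`K` imaginary quadratic,
`p = 𝔭𝔭′` split, `ι′` inducing `𝔭`, any generator pair `(κ₁, κ₂; γ₁, γ₂)`), if `L₂` is a ♯♯-frame of the toric two-variable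
function with constants `(C, X, Y)` (`IsToricTwoVarLFunctionUpTo₂ C X Y …`), then for EVERY `u ∈ ℤ_pˣ` there is a ♯♯-frame
`L₂′` with constants `(C, X, Y·u)` — namely `L₂′ = (1+T₁)^{κ₁ g_u}(1+T₂)^{κ₂ g_u} · L₂` for the grading element `g_u` of §3
(`r_ψ(g_u) = u^b` on the whole interpolation scope) — so a normalisation of `Y/X` can only ever be asked UP TO `ℤ_pˣ`; in
particular the normalised existence (N) of the line `ratwall_thin_comb` (`Y = X·ι′⁻¹(N·|d_K|/4)`) is EQUIVALENT to its
up-to-`ℤ_3ˣ` form (certificate `…ClosedModuloV85`). [cite: SerreAbelianLadic1968, Ch. III §2.3]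
[cite: CastellaWan2023, §2.4 Thm. 2.11 (arXiv:1607.02019)] [cite: HaoLoeffler2025, Thm. 3.5 (arXiv:2405.12611)] -/
theorem exists_isToricTwoVarLFunctionUpTo₂_rescale_snd {N : ℕ} (ι : PadicAlgCl p ≃+* ℂ) (hK : IsImaginaryQuadratic K)
    {𝔭 𝔭' : HeightOneSpectrum (𝓞 K)} (h𝔭 : ((p : ℕ) : 𝓞 K) ∈ 𝔭.asIdeal)
    (h𝔭' : ((p : ℕ) : 𝓞 K) ∈ 𝔭'.asIdeal) (hne : 𝔭' ≠ 𝔭)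
    (hι : Summit.BirchSwinnertonDyer.BirchSwinnertonDyer.Theorems.SchneiderFree.BranchInducesPrime p ι 𝔭)
    (hpair : ZpExtension.IsTopGeneratorPair κ₁ κ₂ γ₁ γ₂)
    {f : CuspForm (CongruenceSubgroup.Gamma0 N) 2} {ΩK : ℂ} {C X Y : ℂ_[p]} {L₂ : PowerSeries (UnrSeries p)}
    (hL : IsToricTwoVarLFunctionUpTo₂ C X Y ι 𝔭 𝔭' κ₁ κ₂ γ₁ γ₂ f ΩK L₂) (u : ℤ_[p]ˣ) :
    ∃ L₂' : PowerSeries (UnrSeries p),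
      IsToricTwoVarLFunctionUpTo₂ C X (Y * algebraMap ℚ_[p] ℂ_[p] ((u : ℤ_[p]) : ℚ_[p])) ι 𝔭 𝔭' κ₁ κ₂ γ₁ γ₂ f ΩK L₂' := by
  obtain ⟨g, hg⟩ := exists_avatarValueAt_eq_unit_pow ι hK h𝔭 h𝔭' hne hι u
  exact ⟨_, isToricTwoVarLFunctionUpTo₂_groupLike_mul hpair g _
    (fun ψ a b _ _ hinf hunr r hr ↦ hg ψ a b r hinf hunr hr) hL⟩

/-- **Corollary (the shape used by the line): a frame normalised UP TO `u ∈ ℤ_pˣ` gives a frame normalised ON THE NOSE.**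
If `L₂` is a ♯♯-frame with constants `(C, X, X·c·u)` for some `c ∈ ℂ_p` and `u ∈ ℤ_pˣ`, then some `L₂′` is a ♯♯-frame with
constants `(C, X, X·c)` (rescale by `u⁻¹`). [cite: SerreAbelianLadic1968, Ch. III §2.3]
[cite: CastellaWan2023, §2.4 Thm. 2.11 (arXiv:1607.02019)] -/
theorem exists_isToricTwoVarLFunctionUpTo₂_of_upToUnit {N : ℕ} (ι : PadicAlgCl p ≃+* ℂ) (hK : IsImaginaryQuadratic K)
    {𝔭 𝔭' : HeightOneSpectrum (𝓞 K)} (h𝔭 : ((p : ℕ) : 𝓞 K) ∈ 𝔭.asIdeal)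
    (h𝔭' : ((p : ℕ) : 𝓞 K) ∈ 𝔭'.asIdeal) (hne : 𝔭' ≠ 𝔭)
    (hι : Summit.BirchSwinnertonDyer.BirchSwinnertonDyer.Theorems.SchneiderFree.BranchInducesPrime p ι 𝔭)
    (hpair : ZpExtension.IsTopGeneratorPair κ₁ κ₂ γ₁ γ₂)
    {f : CuspForm (CongruenceSubgroup.Gamma0 N) 2} {ΩK : ℂ} {C X c : ℂ_[p]} {L₂ : PowerSeries (UnrSeries p)}
    (u : ℤ_[p]ˣ)
    (hL : IsToricTwoVarLFunctionUpTo₂ C X (X * c * algebraMap ℚ_[p] ℂ_[p] ((u : ℤ_[p]) : ℚ_[p]))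
      ι 𝔭 𝔭' κ₁ κ₂ γ₁ γ₂ f ΩK L₂) :
    ∃ L₂' : PowerSeries (UnrSeries p), IsToricTwoVarLFunctionUpTo₂ C X (X * c) ι 𝔭 𝔭' κ₁ κ₂ γ₁ γ₂ f ΩK L₂' := by
  obtain ⟨L₂', hL₂'⟩ := exists_isToricTwoVarLFunctionUpTo₂_rescale_snd ι hK h𝔭 h𝔭' hne hι hpair hL u⁻¹
  refine ⟨L₂', ?_⟩
  have hu : (X * c * algebraMap ℚ_[p] ℂ_[p] ((u : ℤ_[p]) : ℚ_[p])) *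
      algebraMap ℚ_[p] ℂ_[p] (((u⁻¹ : ℤ_[p]ˣ) : ℤ_[p]) : ℚ_[p]) = X * c := by
    rw [mul_assoc, ← map_mul, ← PadicInt.coe_mul, Units.mul_inv, PadicInt.coe_one, map_one, mul_one]
  rwa [hu] at hL₂'

end Rescale

end Summit.BirchSwinnertonDyer.BirchSwinnertonDyer.Theorems.UniversalToricDescentThinComb.GradingRenormalisation

end
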